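import Mathlib
import Summits.Ventures.PercRepro2.CoinTreeCore
import Summits.Ventures.PercRepro2.CoinOrTailKDefs
import Summits.Ventures.PercRepro2.CoinChainBlindDarc

/-!
# The «one uncovered head-blind entry» configuration of §59.14′ in the kernel
(blind cell PercRepro2, night-2 g20; NIGHT2-DARC.md §60)

Seventeen coins on `Fin 11` (s = 0, e₀ = 1, m₁ = 2, m₂ = 3, a' = 4, a = 5, h₁ = 6, h₂ = 7,
h₃ = 8, w = 9, t = 10): the out-tree core `s → e₀, m₁, m₂`; the OR-vertex `a'` entered from ALL
THREE core vertices by sure arcs (the entry `e₀` is NOT a marker and has no head arcs — the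
uncovered head-blind entry of §59.14′, outside every covering theorem); the free-arc vertex `a`
entered from `a'` by one coin; the head `a → h₁ ← m₁`, `a → h₂ ← m₂`, `w → h₃ ← m₂`, `a → h₃`,
`h_i → t`.  Row 2′DARC at `a → w` for the markers `(m₁, m₂)` for EVERY probability vector with
the three entry arcs sure (`darc_oneBlind_example`) — `ent' = U`, so the blindness hypothesis is
vacuous.
-/

namespace Summit.Ventures.PercRepro2.Coin

namespace OneBlindExample

open Classical

/-- The seventeen coins of the example. -/
def arcsO : Fin 17 → Finset (Fin 11 × Fin 11)
  | 0 => {(0, 1)}    -- s → e₀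
  | 1 => {(0, 2)}    -- s → m₁
  | 2 => {(0, 3)}    -- s → m₂
  | 3 => {(1, 4)}    -- e₀ → a' (sure)
  | 4 => {(2, 4)}    -- m₁ → a' (sure)
  | 5 => {(3, 4)}    -- m₂ → a' (sure)
  | 6 => {(4, 5)}    -- a' → a (the chain coin)
  | 7 => {(5, 6)}    -- a → h₁
  | 8 => {(2, 6)}    -- m₁ → h₁
  | 9 => {(6, 10)}   -- h₁ → t
  | 10 => {(5, 7)}   -- a → h₂
  | 11 => {(3, 7)}   -- m₂ → h₂
  | 12 => {(7, 10)}  -- h₂ → t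
  | 13 => {(9, 8)}   -- w → h₃
  | 14 => {(3, 8)}   -- m₂ → h₃
  | 15 => {(8, 10)}  -- h₃ → t
  | _ => {(5, 8)}    -- a → h₃

/-- The entry coins of `a'`. -/
def c'O : Fin 11 → Fin 17
  | 1 => 3
  | 2 => 4
  | 3 => 5
  | _ => 0

/-- The entry coin of `a`. -/
def cO : Fin 11 → Fin 17
  | 4 => 6
  | _ => 0

/-- The tree coins. -/
def tcO : Fin 11 → Fin 17
  | 1 => 0
  | 2 => 1
  | 3 => 2
  | _ => 0

/-- The parent map (the root `s`). -/
def parO : Fin 11 → Fin 11 := fun _ => 0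

/-- The rank. -/
def rkO : Fin 11 → ℕ
  | 1 => 1
  | 2 => 1
  | 3 => 1
  | _ => 0

/-- Every coin is a single arc. -/
lemma sameEnds_o : SameEnds arcsO := by
  intro e xy hxy x'y' hx'y'
  fin_cases e <;> simp [arcsO] at hxy hx'y' <;> subst hxy <;> subst hx'y' <;>
    exact ⟨Or.inl rfl, Or.inr rfl⟩

set_option maxRecDepth 20000 in
/-- The out-tree core `{e₀, m₁, m₂}`. -/
lemma treeCore_o : TreeCore arcsO 0 {1, 2, 3} tcO parO rkO where
  tree := by decide
  par_mem := by decide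
  rank := by decide
  into_C := by decide
  into_s := by decide
  s_notin := by decide

set_option maxRecDepth 20000 in
/-- `a' = 4` is an OR-vertex of the core entered from all three core vertices. -/
lemma orTailK'_o : OrTailK arcsO 0 {1, 2, 3} {1, 2, 3} c'O 4 where
  ent_sub := by decide
  s_notin := by decide
  a_notin := by decide
  a_ne_s := by decide
  into_U := by decide
  into_s := by decide
  into_a := by decide
  arcs_c := by decide
  c_inj := by decide

set_option maxRecDepth 20000 in
/-- `a = 5` is an OR-vertex of `U ∪ {a'}` entered from `a'` alone. -/
lemma orTailK_o : OrTailK arcsO 0 (insert 4 {1, 2, 3}) {4} cO 5 where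
  ent_sub := by decide
  s_notin := by decide
  a_notin := by decide
  a_ne_s := by decide
  into_U := by decide
  into_s := by decide
  into_a := by decide
  arcs_c := by decide
  c_inj := by decide

set_option maxRecDepth 20000 in
/-- **Row 2′DARC at `a → w` for the markers `(m₁, m₂)` on the seventeen-coin instance of §59.14′,
every probability vector with the three entry arcs sure** — the entry `e₀` is neither a marker
nor head-aware (the uncovered head-blind entry); every core vertex is an entry. -/
theorem darc_oneBlind_example {R : Type*} [Field R] [LinearOrder R] [IsStrictOrderedRing R]
    (pr : Fin 17 → R) (hp : IsProbVec pr) (h3 : pr 3 = 1) (h4 : pr 4 = 1) (h5 : pr 5 = 1) :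
    DARC pr arcsO 0 {10} 2 3 5 9 :=
  darc_of_pureChainTree_of_blind pr hp sameEnds_o orTailK'_o
    (by
      intro r hr
      simp only [Finset.mem_insert, Finset.mem_singleton] at hr
      rcases hr with rfl | rfl | rfl
      · exact h3
      · exact h4
      · exact h5)
    orTailK_o treeCore_o (by decide) (by decide) (by decide) (by decide) (by decide) (by decide)
    (by decide)

end OneBlindExample

end Summit.Ventures.PercRepro2.Coin
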